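import Literature.Probability.Process.BrownianMotionComplexProofs
import Mathlib.Probability.Distributions.Gaussian.IsGaussianProcess.Basic
import Mathlib.Probability.Distributions.Gaussian.Real
import Mathlib.Probability.Independence.CharacteristicFunction
import HarnessLib

/-!
# The characteristic function of the finite-dimensional distributions of planar Brownian
# motion

For a planar Brownian motion `Z` (`Literature.Probability.Process.IsBrownianComplex`: real and
imaginary parts are real Brownian motions, independent as path-valued random variables, with
measurable marginals) and finitely many times `τ_i`, dual vectors `v_i ∈ ℝ²`, we compute
`E exp(i Σ_i (v_i⁰ Re Z_{τ_i} + v_i¹ Im Z_{τ_i})) = exp(-σ²/2)`,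
`σ² = Σ_{i,i'} (v_i · v_{i'}) min(τ_i, τ_{i'})` (`IsBrownianComplex.integral_exp_I_sum_eq`),
from Mathlib's Gaussian-process API: a linear statistic of a real Brownian motion is a centred
real Gaussian of variance `Σ a_i a_{i'} min(τ_i, τ_{i'})`
(`IsPreBrownianReal.integral_exp_I_sum_eq`: `IsGaussianProcess`, `HasGaussianLaw.map_eq_gaussianReal`,
`variance_fun_sum'`, `IsPreBrownianReal.covariance_eval`, `charFun_gaussianReal`), and the real
and imaginary statistics are independent (`IndepFun.charFun_map_fun_add_eq_mul`).

This is the Brownian half of the convergence of the finite-dimensional distributions in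
Donsker's theorem for planar walks (`Literature.Barriers.CriticalPhenomena.Edwards2D.tendsto_expect_exp_scaled_pos`
computes the same limit for the rescaled simple random walk).

## References

* O. Kallenberg, *Foundations of Modern Probability* (2nd ed. 2002), Lemma 13.1 (Gaussian
  processes are determined by mean and covariance; linear functionals are Gaussian).
* P. Billingsley, *Convergence of Probability Measures* (2nd ed. 1999), proof of Theorem 8.2.
-/

noncomputable section

open MeasureTheory ProbabilityTheory Complex
open scoped NNReal ENNReal Topology

namespace ProbabilityTheory

variable {Ω : Type*} [MeasurableSpace Ω] {P : Measure Ω} [IsProbabilityMeasure P]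
  {B : ℝ≥0 → Ω → ℝ}

omit [IsProbabilityMeasure P] in
/-- `E e^{iX} = φ_X(1)`: the integral of `exp(iX)` is the characteristic function of the law of
`X` at `1`. [folklore] -/
theorem integral_cexp_I_mul_eq_charFun {X : Ω → ℝ} (hX : AEMeasurable X P) :
    ∫ ω, cexp (I * (X ω : ℂ)) ∂P = charFun (P.map X) 1 := by
  rw [charFun_apply_real, integral_map hX (by fun_prop)]
  refine integral_congr_ae (ae_of_all _ fun ω => ?_)
  push_cast
  ring_nf

/-- **A linear statistic of a real Brownian motion is a centred Gaussian**:
`E exp(i Σ_i a_i B_{τ_i}) = exp(-½ Σ_{i,i'} a_i a_{i'} min(τ_i, τ_{i'}))`. Dot-notation extension in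
Mathlib's namespace `ProbabilityTheory.IsPreBrownianReal`. [cite: Kallenberg2002, Lemma 13.1] -/
theorem IsPreBrownianReal.integral_exp_I_sum_eq (hB : IsPreBrownianReal B P) {ι : Type*}
    (s : Finset ι) (a : ι → ℝ) (τ : ι → ℝ≥0) :
    ∫ ω, cexp (I * ((∑ i ∈ s, a i * B (τ i) ω : ℝ) : ℂ)) ∂P =
      ((Real.exp (-((∑ i ∈ s, ∑ i' ∈ s, a i * a i' * min (τ i : ℝ) (τ i')) / 2)) : ℝ) : ℂ) := by
  classical
  set L : Ω → ℝ := fun ω => ∑ i ∈ s, a i * B (τ i) ω with hL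
  -- `L` is Gaussian
  have hG : IsGaussianProcess (fun (i : ι) ω => a i • B (τ i) ω) P :=
    (hB.isGaussianProcess.comp_right τ).smul a
  have hLg : HasGaussianLaw L P := by
    have := hG.hasGaussianLaw_fun_sum (I := s)
    simpa [hL, smul_eq_mul] using this
  -- mean and variance
  have hmem : ∀ i ∈ s, MemLp (fun ω => a i * B (τ i) ω) 2 P := fun i _ =>
    ((hB.isGaussianProcess.hasGaussianLaw_eval (τ i)).memLp_two).const_mul _
  have hmean : P[L] = 0 := by
    simp only [hL]
    rw [integral_finsetSum _ fun i hi => (hmem i hi).integrable one_le_two]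
    refine Finset.sum_eq_zero fun i _ => ?_
    rw [integral_const_mul, hB.integral_eval, mul_zero]
  have hvar : Var[L; P] = ∑ i ∈ s, ∑ i' ∈ s, a i * a i' * min (τ i : ℝ) (τ i') := by
    simp only [hL]
    rw [variance_fun_sum' hmem]
    refine Finset.sum_congr rfl fun i _ => Finset.sum_congr rfl fun i' _ => ?_
    rw [covariance_const_mul_left, covariance_const_mul_right, hB.covariance_fun_eval]
    push_cast; ring
  -- the characteristic function at `1`
  have hlaw := hLg.map_eq_gaussianReal
  rw [hmean, hvar] at hlaw
  have hnn : (0 : ℝ) ≤ ∑ i ∈ s, ∑ i' ∈ s, a i * a i' * min (τ i : ℝ) (τ i') := by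
    rw [← hvar]; exact variance_nonneg _ _
  have h1 : ∫ ω, cexp (I * ((∑ i ∈ s, a i * B (τ i) ω : ℝ) : ℂ)) ∂P = charFun (P.map L) 1 :=
    integral_cexp_I_mul_eq_charFun hLg.aemeasurable
  rw [h1, hlaw, charFun_gaussianReal, Real.coe_toNNReal _ hnn, Complex.ofReal_exp]
  congr 1
  push_cast
  ring

end ProbabilityTheory

namespace Literature.Probability.Process

variable {Ω : Type*} [MeasurableSpace Ω] {P : Measure Ω} [IsProbabilityMeasure P]
  {Z : ℝ≥0 → Ω → ℂ}

/-- **The characteristic function of the finite-dimensional distributions of planar Brownian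
motion**: for times `τ_i` and dual vectors `v_i ∈ ℝ²`,
`E exp(i Σ_i (v_i⁰ Re Z_{τ_i} + v_i¹ Im Z_{τ_i})) = exp(-σ²/2)` with
`σ² = Σ_{i,i'} (v_i⁰ v_{i'}⁰ + v_i¹ v_{i'}¹) min(τ_i, τ_{i'})` (independent real and imaginary parts, each a
centred Gaussian statistic). [cite: Kallenberg2002, Lemma 13.1] [cite: Billingsley1999, proof of Theorem 8.2] -/
theorem IsBrownianComplex.integral_exp_I_sum_eq (hZ : IsBrownianComplex Z P)
    (hm : ∀ t, Measurable (Z t)) {ι : Type*} (s : Finset ι) (v : ι → Fin 2 → ℝ) (τ : ι → ℝ≥0) :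
    ∫ ω, cexp (I * ((∑ i ∈ s, (v i 0 * (Z (τ i) ω).re + v i 1 * (Z (τ i) ω).im) : ℝ) : ℂ)) ∂P =
      ((Real.exp (-((∑ i ∈ s, ∑ i' ∈ s, (v i 0 * v i' 0 + v i 1 * v i' 1) *
        min (τ i : ℝ) (τ i')) / 2)) : ℝ) : ℂ) := by
  classical
  set Lr : Ω → ℝ := fun ω => ∑ i ∈ s, v i 0 * (Z (τ i) ω).re with hLr
  set Li : Ω → ℝ := fun ω => ∑ i ∈ s, v i 1 * (Z (τ i) ω).im with hLi
  have hLrm : Measurable Lr := Finset.measurable_sum _ fun i _ =>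
    (Complex.measurable_re.comp (hm _)).const_mul _
  have hLim : Measurable Li := Finset.measurable_sum _ fun i _ =>
    (Complex.measurable_im.comp (hm _)).const_mul _
  -- independence of the two statistics
  have hind : IndepFun Lr Li P := by
    have h := hZ.indepFun.comp (φ := fun (f : ℝ≥0 → ℝ) => ∑ i ∈ s, v i 0 * f (τ i))
      (ψ := fun (f : ℝ≥0 → ℝ) => ∑ i ∈ s, v i 1 * f (τ i))
      (Finset.measurable_sum _ fun i _ => (measurable_pi_apply _).const_mul _)
      (Finset.measurable_sum _ fun i _ => (measurable_pi_apply _).const_mul _)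
    exact h
  -- split the exponential
  have hsum : ∀ ω, (∑ i ∈ s, (v i 0 * (Z (τ i) ω).re + v i 1 * (Z (τ i) ω).im) : ℝ) = Lr ω + Li ω := by
    intro ω; simp only [hLr, hLi, ← Finset.sum_add_distrib]
  simp_rw [hsum]
  have hchar := congrFun (hind.charFun_map_fun_add_eq_mul hLrm.aemeasurable hLim.aemeasurable) 1
  rw [Pi.mul_apply] at hchar
  have e0 : ∫ ω, cexp (I * ((Lr ω + Li ω : ℝ) : ℂ)) ∂P = charFun (P.map fun ω => Lr ω + Li ω) 1 :=
    integral_cexp_I_mul_eq_charFun (hLrm.add hLim).aemeasurable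
  have er : charFun (P.map Lr) 1 = ∫ ω, cexp (I * ((∑ i ∈ s, v i 0 * (Z (τ i) ω).re : ℝ) : ℂ)) ∂P :=
    (integral_cexp_I_mul_eq_charFun hLrm.aemeasurable).symm
  have ei : charFun (P.map Li) 1 = ∫ ω, cexp (I * ((∑ i ∈ s, v i 1 * (Z (τ i) ω).im : ℝ) : ℂ)) ∂P :=
    (integral_cexp_I_mul_eq_charFun hLim.aemeasurable).symm
  rw [e0, hchar, er, ei, hZ.re.toIsPreBrownianReal.integral_exp_I_sum_eq s (fun i => v i 0) τ,
    hZ.im.toIsPreBrownianReal.integral_exp_I_sum_eq s (fun i => v i 1) τ, ← Complex.ofReal_mul,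
    ← Real.exp_add]
  congr 1; congr 1
  have : ∑ i ∈ s, ∑ i' ∈ s, (v i 0 * v i' 0 + v i 1 * v i' 1) * min (τ i : ℝ) (τ i') =
      (∑ i ∈ s, ∑ i' ∈ s, v i 0 * v i' 0 * min (τ i : ℝ) (τ i')) +
        ∑ i ∈ s, ∑ i' ∈ s, v i 1 * v i' 1 * min (τ i : ℝ) (τ i') := by
    rw [← Finset.sum_add_distrib]
    refine Finset.sum_congr rfl fun i _ => ?_
    rw [← Finset.sum_add_distrib]
    refine Finset.sum_congr rfl fun i' _ => ?_
    ring
  rw [this]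
  ring

end Literature.Probability.Process

end
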